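import Summits.Schanuel.Schanuel.Theorems.ZilberEacParamCurveEscape
import Summits.Schanuel.Schanuel.Theorems.ZilberEacGraphCurveEdge
import HarnessLib

/-!
# Polynomially parametrised base curves, IV: the edge decomposition in two free variables and
# the escaping exponential points of `C × Z(P)`

HONEST FRAMING.  Cell `pub-schanuel` (Zilber's Exponential-Algebraic Closedness, case ladder;
host summit Schanuel), seat 2, gen 19.  Fourth file of the series on product surfaces over a
polynomially parametrised base curve `C = {(g₀(t), g₁(t))}` (Mantova–Masser's OPEN density
question, PLMS 2024 §1 p. 5).  NOT Schanuel's conjecture (neither used nor implied; EAC ⇏ SC);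
`EC(3,2)` stays OPEN.

THE MECHANISM.  `P(e^{x₀}, e^{x₁}) = Σ_v c_v e^{v₀ x₀ + v₁ x₁}`; along a lower-left edge
`(s, v_b)` of `supp P` (gen 16, `exists_lowerLeft_edge`),
`P(e^{x₀}, e^{x₁}) = e^{⟨v_b, x⟩} (Q(e^{x₁ + s x₀}) + E)` with `‖E‖ ≤ C_B e^{δ Re x₀}` for
`Re x₀ ≤ 0`, `|Re(x₁ + s x₀)| ≤ B` — gen 16's identity `eval_exp_eq_mul_edgeSum` is an identity in
the two numbers `(x₀, x₁) = (z, p(z))`, and we read it with the constant polynomial `p = C x₁`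
(Part A).  Substituting `x = (g₀(t), g₁(t))` gives `Q(e^{R(t)}) + E(t)` with
`R = g₁ + s g₀ ∈ ℂ[t]` and the regime `Re g₀(t) ≤ 0`, `|Re R(t)| ≤ B` of the directional engine
(file III) with `G = g₀`; a root direction `ω` of `R` with `Re(lc(g₀) ω^{deg g₀}) < 0` (file I)
then yields exponential points of `C × Z(P)` along which `x₀ = g₀(t_k)` degenerates,
`|Re g₀(t_k)| / log(2 + ‖g₀(t_k)‖) → ∞` (Part B).  Part C supplies the direction when
`1 ≤ deg g₀ < deg g₁`, and when `deg g₀ = deg g₁ ≥ 2` with `lc(g₁)/lc(g₀) ∉ ℝ`.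
-/

noncomputable section

open Filter Topology Metric Set Complex
open Literature.ModelTheory.Zilber

set_option linter.dupNamespace false

namespace Summit.Schanuel.Schanuel.Theorems

/-! ## Part A. The edge decomposition in two free variables -/

section EdgeSum

variable {P : MvPolynomial (Fin 2) ℂ} {s : ℝ} {vb : Fin 2 →₀ ℕ}

/-- **Edge decomposition of `P(e^{x₀}, e^{x₁})`** (gen 16's `eval_exp_eq_mul_edgeSum` read with the
constant base polynomial `C x₁`):
`P(e^{x₀}, e^{x₁}) = e^{v_{b,0} x₀ + v_{b,1} x₁} (Q(e^{x₁ + s x₀}) + E(x₀, x₁))`. -/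
theorem eval_exp_exp_eq_mul_edgeSum
    (hE2 : ∀ v ∈ P.support, ((v 0 : ℝ) - s * v 1) = (vb 0 : ℝ) - s * vb 1 → vb 1 ≤ v 1)
    (x₀ x₁ : ℂ) :
    MvPolynomial.eval ![exp x₀, exp x₁] P =
      exp ((vb 0 : ℂ) * x₀ + (vb 1 : ℂ) * x₁) *
        ((∑ v ∈ P.support.filter (fun v : Fin 2 →₀ ℕ => ((v 0 : ℝ) - s * v 1) = (vb 0 : ℝ) - s * vb 1),
            Polynomial.C (P.coeff v) * Polynomial.X ^ (v 1 - vb 1)).eval (exp (x₁ + (s : ℂ) * x₀)) +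
          ∑ v ∈ P.support.filter (fun v : Fin 2 →₀ ℕ => ¬ ((v 0 : ℝ) - s * v 1) = (vb 0 : ℝ) - s * vb 1),
            P.coeff v * exp ((((v 0 : ℝ) - s * v 1 - ((vb 0 : ℝ) - s * vb 1) : ℝ) : ℂ) * x₀ +
              (((v 1 : ℝ) - vb 1 : ℝ) : ℂ) * (x₁ + (s : ℂ) * x₀))) := by
  have h := eval_exp_eq_mul_edgeSum (p := Polynomial.C x₁) hE2 x₀
  simp only [Polynomial.eval_add, Polynomial.eval_C, Polynomial.eval_mul, Polynomial.eval_X] at h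
  exact h

/-- **The off-edge part is small in the regime** `Re x₀ ≤ 0`, `|Re(x₁ + s x₀)| ≤ B`:
`‖E(x₀, x₁)‖ ≤ (Σ_{v ∉ M} ‖c_v‖ e^{|v₁ - v_{b,1}| B}) e^{δ Re x₀}` (`δ` at most every positive weight
gap). -/
theorem norm_offEdgeSum_le₂ {δ B : ℝ}
    (hδ : ∀ v ∈ P.support, ¬ ((v 0 : ℝ) - s * v 1) = (vb 0 : ℝ) - s * vb 1 →
      δ ≤ ((v 0 : ℝ) - s * v 1) - ((vb 0 : ℝ) - s * vb 1))
    {x₀ x₁ : ℂ} (hx : x₀.re ≤ 0) (hB : |(x₁ + (s : ℂ) * x₀).re| ≤ B) :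
    ‖∑ v ∈ P.support.filter (fun v : Fin 2 →₀ ℕ => ¬ ((v 0 : ℝ) - s * v 1) = (vb 0 : ℝ) - s * vb 1),
        P.coeff v * exp ((((v 0 : ℝ) - s * v 1 - ((vb 0 : ℝ) - s * vb 1) : ℝ) : ℂ) * x₀ +
          (((v 1 : ℝ) - vb 1 : ℝ) : ℂ) * (x₁ + (s : ℂ) * x₀))‖ ≤
      (∑ v ∈ P.support.filter (fun v : Fin 2 →₀ ℕ => ¬ ((v 0 : ℝ) - s * v 1) = (vb 0 : ℝ) - s * vb 1),
          ‖P.coeff v‖ * Real.exp (|(v 1 : ℝ) - vb 1| * B)) * Real.exp (δ * x₀.re) := by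
  have hB' : |((Polynomial.C x₁ + Polynomial.C (s : ℂ) * Polynomial.X).eval x₀).re| ≤ B := by
    simpa only [Polynomial.eval_add, Polynomial.eval_C, Polynomial.eval_mul, Polynomial.eval_X] using hB
  have h := norm_offEdgeSum_le (P := P) (p := Polynomial.C x₁) hδ hx hB'
  simp only [Polynomial.eval_add, Polynomial.eval_C, Polynomial.eval_mul, Polynomial.eval_X] at h
  exact h

end EdgeSum

/-! ## Part B. Escaping exponential points of `C × Z(P)` -/

/-- **Escaping zeros of `P(e^{g₀(t)}, e^{g₁(t)})`.**  Let `P ∈ ℂ[y₀, y₁]` have two monomials with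
different `y₁`-exponents, let `deg g₀ ≥ 1`, and suppose that for every real `s` the polynomial
`R_s = g₁ + s g₀` has degree `≥ 2` and a root direction `ω` (`lc(R_s) ω^{deg R_s} = ±2πi`) with
`Re(lc(g₀) ω^{deg g₀}) < 0`.  Then there are `t_k` with `P(e^{g₀(t_k)}, e^{g₁(t_k)}) = 0` and
`|Re g₀(t_k)| / log(2 + ‖g₀(t_k)‖) → ∞`. (new) -/
theorem exists_paramCurve_expPoints (g₀ g₁ : Polynomial ℂ) (hg₀ : 1 ≤ g₀.natDegree)
    (P : MvPolynomial (Fin 2) ℂ) (h2 : ∃ v ∈ P.support, ∃ v' ∈ P.support, v 1 ≠ v' 1)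
    (hdir : ∀ s : ℝ, 2 ≤ (g₁ + Polynomial.C (s : ℂ) * g₀).natDegree ∧
      ∃ (ω : ℂ) (σ : ℤ), (σ = 1 ∨ σ = -1) ∧
        (g₁ + Polynomial.C (s : ℂ) * g₀).leadingCoeff *
            ω ^ (g₁ + Polynomial.C (s : ℂ) * g₀).natDegree = 2 * Real.pi * I * σ ∧
        (g₀.leadingCoeff * ω ^ g₀.natDegree).re < 0) :
    ∃ t : ℕ → ℂ, (∀ k, MvPolynomial.eval ![exp (g₀.eval (t k)), exp (g₁.eval (t k))] P = 0) ∧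
      Tendsto (fun k => |(g₀.eval (t k)).re| / Real.log (2 + ‖g₀.eval (t k)‖)) atTop atTop := by
  classical
  obtain ⟨s, vb, hvb, hE1, hE2, hE3⟩ := exists_lowerLeft_edge P.support h2
  obtain ⟨hdR, ω, σ, hσ, hω, hre⟩ := hdir s
  set R : Polynomial ℂ := g₁ + Polynomial.C (s : ℂ) * g₀ with hR
  have hReval : ∀ t : ℂ, R.eval t = g₁.eval t + (s : ℂ) * g₀.eval t := by
    intro t; simp [hR, Polynomial.eval_add, Polynomial.eval_mul]
  -- the edge polynomial
  set Q : Polynomial ℂ := ∑ v ∈ P.support.filter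
      (fun v : Fin 2 →₀ ℕ => ((v 0 : ℝ) - s * v 1) = (vb 0 : ℝ) - s * vb 1),
    Polynomial.C (P.coeff v) * Polynomial.X ^ (v 1 - vb 1) with hQ
  have hQ0 : Q.eval 0 ≠ 0 := by
    rw [hQ, eval_zero_edgePoly hvb hE2]
    exact MvPolynomial.mem_support_iff.1 hvb
  have hQd : 0 < Q.natDegree := natDegree_edgePoly_pos hE2 hE3
  -- the off-edge part and its weight gap `δ`
  set N := P.support.filter (fun v : Fin 2 →₀ ℕ => ¬ ((v 0 : ℝ) - s * v 1) = (vb 0 : ℝ) - s * vb 1)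
    with hN
  obtain ⟨δ, hδpos, hδ⟩ : ∃ δ : ℝ, 0 < δ ∧ ∀ v ∈ P.support,
      ¬ ((v 0 : ℝ) - s * v 1) = (vb 0 : ℝ) - s * vb 1 →
        δ ≤ ((v 0 : ℝ) - s * v 1) - ((vb 0 : ℝ) - s * vb 1) := by
    by_cases hNe : N.Nonempty
    · obtain ⟨vm, hvm, hvmmin⟩ := N.exists_min_image
        (fun v => ((v 0 : ℝ) - s * v 1) - ((vb 0 : ℝ) - s * vb 1)) hNe
      obtain ⟨hvmA, hvmw⟩ := Finset.mem_filter.1 hvm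
      refine ⟨((vm 0 : ℝ) - s * vm 1) - ((vb 0 : ℝ) - s * vb 1), ?_, fun v hv hvw =>
        hvmmin v (Finset.mem_filter.2 ⟨hv, hvw⟩)⟩
      have := hE1 vm hvmA
      rcases this.lt_or_eq with h | h
      · linarith
      · exact absurd h.symm hvmw
    · refine ⟨1, zero_lt_one, fun v hv hvw => ?_⟩
      exact absurd ⟨v, Finset.mem_filter.2 ⟨hv, hvw⟩⟩ hNe
  set E : ℂ → ℂ := fun t => ∑ v ∈ N,
    P.coeff v * exp ((((v 0 : ℝ) - s * v 1 - ((vb 0 : ℝ) - s * vb 1) : ℝ) : ℂ) * g₀.eval t +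
      (((v 1 : ℝ) - vb 1 : ℝ) : ℂ) * R.eval t) with hEdef
  have hEdiff : Differentiable ℂ E := by
    refine Differentiable.fun_sum fun v _ => ?_
    refine (differentiable_const _).mul ?_
    refine (((differentiable_const _).mul (Polynomial.differentiable _)).add
      ((differentiable_const _).mul (Polynomial.differentiable _))).cexp
  have hEb : ∀ B : ℝ, ∃ C : ℝ, 0 ≤ C ∧
      ∀ t : ℂ, (g₀.eval t).re ≤ 0 → |(R.eval t).re| ≤ B →
        ‖E t‖ ≤ C * Real.exp (δ * (g₀.eval t).re) := by
    intro B
    refine ⟨∑ v ∈ N, ‖P.coeff v‖ * Real.exp (|(v 1 : ℝ) - vb 1| * B),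
      Finset.sum_nonneg fun v _ => by positivity, fun t ht htB => ?_⟩
    have htB' : |(g₁.eval t + (s : ℂ) * g₀.eval t).re| ≤ B := by rwa [hReval] at htB
    have h := norm_offEdgeSum_le₂ (P := P) hδ ht htB'
    simp only [hEdef, hReval]
    exact h
  -- the engine with `G = g₀`
  obtain ⟨t, L, A, hL, ht⟩ :=
    exists_escape_zeros_dir R Q g₀ hdR hQ0 hQd hg₀ ω σ hσ hω hre E hEdiff hδpos hEb
  refine ⟨t, fun k => ?_, tendsto_abs_re_div_log_of_escape hL (fun k => (ht k).2.1)
    (fun k => (ht k).2.2)⟩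
  rw [eval_exp_exp_eq_mul_edgeSum hE2 (g₀.eval (t k)) (g₁.eval (t k))]
  have h := (ht k).1
  rw [hQ, hEdef] at h
  simp only [hReval] at h
  rw [h, mul_zero]

/-! ## Part C. The root direction in the two regimes -/

/-- `0 < m < d` excludes `d ∣ m`. -/
theorem not_dvd_of_pos_of_lt {d m : ℕ} (hm : 0 < m) (hlt : m < d) : ¬ d ∣ m := fun h =>
  absurd (Nat.eq_zero_of_dvd_of_lt h hlt) (by omega)

/-- **Unequal degrees** `1 ≤ deg g₀ < deg g₁`: for every real `s`, `R_s = g₁ + s g₀` has the degree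
and leading coefficient of `g₁`, and a root direction with `Re(lc(g₀) ω^{deg g₀}) < 0` exists
(file I, `deg g₁ ∤ deg g₀`). (new) -/
theorem paramCurve_dir_of_lt (g₀ g₁ : Polynomial ℂ) (hg₀ : 1 ≤ g₀.natDegree)
    (hlt : g₀.natDegree < g₁.natDegree) (s : ℝ) :
    2 ≤ (g₁ + Polynomial.C (s : ℂ) * g₀).natDegree ∧
      ∃ (ω : ℂ) (σ : ℤ), (σ = 1 ∨ σ = -1) ∧
        (g₁ + Polynomial.C (s : ℂ) * g₀).leadingCoeff *
            ω ^ (g₁ + Polynomial.C (s : ℂ) * g₀).natDegree = 2 * Real.pi * I * σ ∧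
        (g₀.leadingCoeff * ω ^ g₀.natDegree).re < 0 := by
  have hlt' : (Polynomial.C (s : ℂ) * g₀).degree < g₁.degree :=
    Polynomial.degree_lt_degree (lt_of_le_of_lt (Polynomial.natDegree_C_mul_le _ _) hlt)
  have hdeg : (g₁ + Polynomial.C (s : ℂ) * g₀).natDegree = g₁.natDegree :=
    Polynomial.natDegree_add_eq_left_of_degree_lt hlt'
  have hlc : (g₁ + Polynomial.C (s : ℂ) * g₀).leadingCoeff = g₁.leadingCoeff :=
    Polynomial.leadingCoeff_add_of_degree_lt' hlt'
  rw [hdeg, hlc]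
  have hg₁0 : g₁ ≠ 0 := by
    rintro rfl
    rw [Polynomial.natDegree_zero] at hlt
    omega
  have hg₀0 : g₀ ≠ 0 := by
    rintro rfl
    rw [Polynomial.natDegree_zero] at hg₀
    omega
  refine ⟨by omega, ?_⟩
  obtain ⟨ω, σ, hσ, hω, hre⟩ := exists_rootDirection_re_neg_of_not_dvd g₁.leadingCoeff
    g₀.leadingCoeff (Polynomial.leadingCoeff_ne_zero.2 hg₁0) (Polynomial.leadingCoeff_ne_zero.2 hg₀0)
    (d := g₁.natDegree) (m := g₀.natDegree) (by omega) (not_dvd_of_pos_of_lt (by omega) hlt)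
  exact ⟨ω, σ, hσ, hω, hre⟩

/-- **Equal degrees** `deg g₀ = deg g₁ ≥ 2` with `lc(g₁)/lc(g₀) ∉ ℝ`: for every real `s`,
`R_s = g₁ + s g₀` has degree `deg g₀`, leading coefficient `lc(g₁) + s lc(g₀) ≠ 0`, and a root
direction with `Re(lc(g₀) ω^{deg g₀}) < 0` exists (file I, `lc(g₀)/lc(R_s) ∉ ℝ`). (new) -/
theorem paramCurve_dir_of_eq (g₀ g₁ : Polynomial ℂ) (hd : 2 ≤ g₀.natDegree)
    (heq : g₁.natDegree = g₀.natDegree)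
    (him : (g₁.leadingCoeff / g₀.leadingCoeff).im ≠ 0) (s : ℝ) :
    2 ≤ (g₁ + Polynomial.C (s : ℂ) * g₀).natDegree ∧
      ∃ (ω : ℂ) (σ : ℤ), (σ = 1 ∨ σ = -1) ∧
        (g₁ + Polynomial.C (s : ℂ) * g₀).leadingCoeff *
            ω ^ (g₁ + Polynomial.C (s : ℂ) * g₀).natDegree = 2 * Real.pi * I * σ ∧
        (g₀.leadingCoeff * ω ^ g₀.natDegree).re < 0 := by
  have hg₀0 : g₀ ≠ 0 := by
    rintro rfl
    rw [Polynomial.natDegree_zero] at hd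
    omega
  have hg₁0 : g₁ ≠ 0 := by
    rintro rfl
    rw [Polynomial.natDegree_zero] at heq
    omega
  have hlc₀ : g₀.leadingCoeff ≠ 0 := Polynomial.leadingCoeff_ne_zero.2 hg₀0
  have hlc₁ : g₁.leadingCoeff ≠ 0 := Polynomial.leadingCoeff_ne_zero.2 hg₁0
  -- `lc(g₁) + s lc(g₀) ≠ 0` and the ratio `lc(g₀)/(lc(g₁) + s lc(g₀))` is non-real
  have hsum : g₁.leadingCoeff + (s : ℂ) * g₀.leadingCoeff ≠ 0 := by
    intro h0
    apply him
    have : g₁.leadingCoeff / g₀.leadingCoeff = -(s : ℂ) := by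
      field_simp
      linear_combination h0
    rw [this]; simp
  have him' : (g₀.leadingCoeff / (g₁.leadingCoeff + (s : ℂ) * g₀.leadingCoeff)).im ≠ 0 := by
    intro h0
    apply him
    -- if `w = lc₀/(lc₁ + s lc₀)` is real (and nonzero) then `lc₁/lc₀ = 1/w - s` is real
    set w : ℂ := g₀.leadingCoeff / (g₁.leadingCoeff + (s : ℂ) * g₀.leadingCoeff) with hw
    have hw0 : w ≠ 0 := div_ne_zero hlc₀ hsum
    have hwre : w = (w.re : ℂ) := by
      apply Complex.ext <;> simp [h0]
    have hratio : g₁.leadingCoeff / g₀.leadingCoeff = 1 / w - (s : ℂ) := by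
      rw [hw]
      field_simp
      ring
    rw [hratio, hwre]
    have hwre0 : (w.re : ℂ) ≠ 0 := by rw [← hwre]; exact hw0
    simp [Complex.sub_im, Complex.ofReal_im]
  -- degree and leading coefficient of `R_s`
  have hdeglc : (g₁ + Polynomial.C (s : ℂ) * g₀).natDegree = g₀.natDegree ∧
      (g₁ + Polynomial.C (s : ℂ) * g₀).leadingCoeff = g₁.leadingCoeff + (s : ℂ) * g₀.leadingCoeff := by
    by_cases hs0 : s = 0
    · subst hs0
      simp [heq]
    · have hsC : (s : ℂ) ≠ 0 := Complex.ofReal_ne_zero.mpr hs0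
      have hdegeq : g₁.degree = (Polynomial.C (s : ℂ) * g₀).degree := by
        rw [Polynomial.degree_C_mul hsC, Polynomial.degree_eq_natDegree hg₁0,
          Polynomial.degree_eq_natDegree hg₀0, heq]
      have hlcs : (Polynomial.C (s : ℂ) * g₀).leadingCoeff = (s : ℂ) * g₀.leadingCoeff := by
        rw [Polynomial.leadingCoeff_mul, Polynomial.leadingCoeff_C]
      have hsum' : g₁.leadingCoeff + (Polynomial.C (s : ℂ) * g₀).leadingCoeff ≠ 0 := by
        rwa [hlcs]
      constructor
      · have h1 := Polynomial.degree_add_eq_of_leadingCoeff_add_ne_zero hsum'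
        have h2 : (g₁ + Polynomial.C (s : ℂ) * g₀).degree = (g₀.natDegree : WithBot ℕ) := by
          rw [h1, max_eq_left hdegeq.symm.le, Polynomial.degree_eq_natDegree hg₁0, heq]
        exact Polynomial.natDegree_eq_of_degree_eq_some h2
      · rw [Polynomial.leadingCoeff_add_of_degree_eq hdegeq hsum', hlcs]
  obtain ⟨hdeg, hlc⟩ := hdeglc
  rw [hdeg, hlc]
  refine ⟨hd, ?_⟩
  obtain ⟨ω, σ, hσ, hω, hre⟩ := exists_rootDirection_re_neg_of_im_ne_zero
    (g₁.leadingCoeff + (s : ℂ) * g₀.leadingCoeff) g₀.leadingCoeff hsum hd him'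
  exact ⟨ω, σ, hσ, hω, hre⟩

end Summit.Schanuel.Schanuel.Theorems
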